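import Literature.Analysis.FluidPDE.BoltzmannEquation
import Literature.MathematicalPhysics.KineticTheory.HardSphereEulerProofs
import Literature.Analysis.FunctionSpaces.TorusCalculusProofs
import Literature.Analysis.FunctionSpaces.TorusMollifier
import HarnessLib

/-!
# Spatial transfer for the K2R consistency step: finite differences on `𝕋³` and sphere moments

Route `EnskogAdjointDuality` of `AtomisticToContinuum/HydrodynamicLimit`, crux K2R
(`AdjointEnskogTestFamilyR`, stmt-AtomisticToContinuum-11592), line `birth`, stub B3b
`stub_spatialTransfer`.  Two generic analysis facts used to evaluate the hydrodynamic part of the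
collisional transfer `−(λ/2)∫_{S²}dω ∫_{𝕋³}dx W(x)[(β(x)−β(x+εω))·ω + …]` with a SMOOTH weight `W`
and merely continuous (Lipschitz, `N`-dependent) coefficients `β`:

* (i) `k2r_abs_integral_mul_sub_translate_sub_le` — **finite differences against a smooth weight are
  gradients up to `O(ε²)`**: for `W` smooth on `𝕋³` with `∇W` `K₂`-Lipschitz, `β` continuous with
  `|β| ≤ C_β` and `‖a‖ ≤ 1`,
  `|∫ W(x)(β(x) − β(x+εa)) dx − ε ∫ (a·∇W)β| ≤ K₂ C_β ε²`.
  Translation invariance of Haar measure on `𝕋³` moves the difference onto `W`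
  (`∫ W(x)β(x+p) = ∫ W(x−p)β(x)`), and the first-order Taylor remainder of `W` along the segment
  `τ ↦ x − p + τp` is bounded through the Lipschitz constant of `∇W`.
* (ii) `k2r_integral_inner_mul_inner_sphereMeasure` — **second moments of the surface measure of
  `S²`** (`sphereMeasure = volume.toSphere`, total mass `4π`): `∫ (a·ω)(b·ω) dσ(ω) = (4π/3) a·b`.
  Proof without any parametrisation of `S²`: integrate `(a·x)(b·x)M(x)` and `|x|²M(x)` over `ℝ³`
  against the Maxwellian `M` both in polar coordinates (Mathlib's
  `measurePreserving_homeomorphUnitSphereProd`) and as Gaussian moments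
  (`covarianceBilin_stdGaussian`, `E|x|² = 3`); the common radial integral cancels.

The registered statement `stub_spatialTransfer` is the conjunction of (i) and (ii).

References: C. Cercignani, R. Illner, M. Pulvirenti, *The Mathematical Theory of Dilute Gases*
(1994), §3.1 [CIP1994]; folklore calculus on the flat torus.
-/

noncomputable section

open MeasureTheory Real Set Metric Filter Topology ProbabilityTheory
open scoped InnerProductSpace ENNReal

namespace Summit.AtomisticToContinuum.HydrodynamicLimit.Theorems.EnskogAdjointDuality

open Literature.Analysis.FluidPDE Literature.MathematicalPhysics.KineticTheory
open Literature.Analysis.FunctionSpaces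

/-! ## (ii) Second moments of the surface measure of `S²` -/

/-- Covariance of the standard Gaussian on `ℝ³`: `∫ (a·x)(b·x) dN(0,I)(x) = a·b`
(Mathlib's `covarianceBilin_stdGaussian`). [folklore] -/
theorem k2r_integral_inner_mul_inner_stdGaussian (a b : EuclideanSpace ℝ (Fin 3)) :
    ∫ x, ⟪a, x⟫_ℝ * ⟪b, x⟫_ℝ ∂stdGaussian (EuclideanSpace ℝ (Fin 3)) = ⟪a, b⟫_ℝ := by
  have h := covarianceBilin_apply (μ := stdGaussian (EuclideanSpace ℝ (Fin 3)))
    IsGaussian.memLp_two_id a b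
  have h0 : ∫ x, id x ∂stdGaussian (EuclideanSpace ℝ (Fin 3)) = 0 := integral_id_stdGaussian
  rw [h0] at h
  simp only [sub_zero] at h
  rw [← h, covarianceBilin_stdGaussian, innerSL_apply_apply]

/-- **Polar coordinates against the Maxwellian** for a `2`-homogeneous angular factor `φ`
(`φ(cx) = c²φ(x)`, `c > 0`): `∫_{ℝ³} M(x)φ(x) dx = (∫_{S²} φ dσ) · ∫₀^∞ r⁴ (2π)^{-3/2} e^{-r²/2} dr`
(Mathlib's polar decomposition `measurePreserving_homeomorphUnitSphereProd`: Lebesgue measure on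
`ℝ³ ∖ {0}` is `volume.toSphere ⊗ r² dr`). [folklore] -/
theorem k2r_integral_globalMaxwellian_mul_of_homog (φ : EuclideanSpace ℝ (Fin 3) → ℝ)
    (hφ : ∀ c : ℝ, 0 < c → ∀ x, φ (c • x) = c ^ 2 * φ x) :
    ∫ x, globalMaxwellian x * φ x =
      (∫ ω : sphere (0 : EuclideanSpace ℝ (Fin 3)) 1, φ ω ∂sphereMeasure) *
        ∫ r in Ioi (0 : ℝ), r ^ 4 * ((2 * π) ^ (-(3 : ℝ) / 2) * rexp (-r ^ 2 / 2)) := by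
  set f : EuclideanSpace ℝ (Fin 3) → ℝ := fun x => globalMaxwellian x * φ x with hf
  set ψ : ℝ → ℝ := fun r => r ^ 2 * ((2 * π) ^ (-(3 : ℝ) / 2) * rexp (-r ^ 2 / 2)) with hψ
  set F : sphere (0 : EuclideanSpace ℝ (Fin 3)) 1 × Ioi (0 : ℝ) → ℝ :=
    fun p => φ p.1 * ψ p.2 with hF
  have hdim : Module.finrank ℝ (EuclideanSpace ℝ (Fin 3)) - 1 = 2 := by
    rw [finrank_euclideanSpace_fin]
  have hmp := (volume : Measure (EuclideanSpace ℝ (Fin 3))).measurePreserving_homeomorphUnitSphereProd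
  rw [hdim] at hmp
  -- remove the origin
  have h1 : ∫ x, f x = ∫ x : ({(0 : EuclideanSpace ℝ (Fin 3))}ᶜ : Set (EuclideanSpace ℝ (Fin 3))),
      f x ∂(Measure.comap Subtype.val volume) := by
    rw [integral_subtype_comap (measurableSet_singleton _).compl f, restrict_compl_singleton]
  -- the integrand in polar coordinates
  have h2 : ∀ x : ({(0 : EuclideanSpace ℝ (Fin 3))}ᶜ : Set (EuclideanSpace ℝ (Fin 3))),
      f x = F (homeomorphUnitSphereProd (EuclideanSpace ℝ (Fin 3)) x) := by
    intro x
    have hx : (x : EuclideanSpace ℝ (Fin 3)) ≠ 0 := x.2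
    have hn : 0 < ‖(x : EuclideanSpace ℝ (Fin 3))‖ := norm_pos_iff.2 hx
    simp only [hf, hF, hψ, homeomorphUnitSphereProd_apply_fst_coe,
      homeomorphUnitSphereProd_apply_snd_coe]
    rw [hφ _ (inv_pos.2 hn), globalMaxwellian, finrank_euclideanSpace_fin]
    push_cast
    field_simp
  have h3 : ∫ x : ({(0 : EuclideanSpace ℝ (Fin 3))}ᶜ : Set (EuclideanSpace ℝ (Fin 3))),
      F (homeomorphUnitSphereProd (EuclideanSpace ℝ (Fin 3)) x) ∂(Measure.comap Subtype.val volume)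
      = ∫ p, F p ∂((volume : Measure (EuclideanSpace ℝ (Fin 3))).toSphere.prod (Measure.volumeIoiPow 2)) :=
    hmp.integral_comp (Homeomorph.measurableEmbedding _) F
  have h4 : ∫ p, F p ∂((volume : Measure (EuclideanSpace ℝ (Fin 3))).toSphere.prod (Measure.volumeIoiPow 2))
      = (∫ ω, φ ((ω : sphere (0 : EuclideanSpace ℝ (Fin 3)) 1) : EuclideanSpace ℝ (Fin 3))
          ∂(volume : Measure (EuclideanSpace ℝ (Fin 3))).toSphere) *
        ∫ r, ψ ((r : Ioi (0 : ℝ)) : ℝ) ∂(Measure.volumeIoiPow 2) :=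
    integral_prod_mul (μ := (volume : Measure (EuclideanSpace ℝ (Fin 3))).toSphere)
      (ν := Measure.volumeIoiPow 2)
      (fun ω : sphere (0 : EuclideanSpace ℝ (Fin 3)) 1 => φ (ω : EuclideanSpace ℝ (Fin 3)))
      (fun r : Ioi (0 : ℝ) => ψ (r : ℝ))
  have h5 : ∫ r, ψ ((r : Ioi (0 : ℝ)) : ℝ) ∂(Measure.volumeIoiPow 2)
      = ∫ r in Ioi (0 : ℝ), r ^ 4 * ((2 * π) ^ (-(3 : ℝ) / 2) * rexp (-r ^ 2 / 2)) := by
    simp only [Measure.volumeIoiPow, ENNReal.ofReal]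
    rw [integral_withDensity_eq_integral_smul (measurable_subtype_coe.pow_const _).real_toNNReal,
      integral_subtype_comap measurableSet_Ioi
        (fun a : ℝ => Real.toNNReal (a ^ 2) • ψ a)]
    refine setIntegral_congr_fun measurableSet_Ioi fun x hx => ?_
    rw [NNReal.smul_def, Real.coe_toNNReal _ (pow_nonneg hx.out.le _), smul_eq_mul, hψ]
    ring
  rw [h1, integral_congr_ae (Eventually.of_forall h2), h3, h4, h5]
  rfl

/-- The total mass of the surface measure of `S² ⊆ ℝ³` is `4π`
(`σ(S²) = 3 · vol(B³) = 3 · (4π/3)`, Mathlib's `toSphere_real_apply_univ`, `volume_ball_fin_three`).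
[folklore] -/
theorem k2r_sphereMeasure_real_univ :
    (sphereMeasure : Measure (sphere (0 : EuclideanSpace ℝ (Fin 3)) 1)).real univ = 4 * π := by
  change ((volume : Measure (EuclideanSpace ℝ (Fin 3))).toSphere).real univ = 4 * π
  rw [Measure.toSphere_real_apply_univ, finrank_euclideanSpace_fin, measureReal_def,
    EuclideanSpace.volume_ball_fin_three]
  rw [ENNReal.ofReal_one, one_pow, one_mul, ENNReal.toReal_ofReal (by positivity)]
  push_cast
  ring

/-- **Second moments of the surface measure of `S²`**: for the un-normalised surface measure
`sphereMeasure = volume.toSphere` on `S² ⊆ ℝ³` (total mass `4π`),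
`∫_{S²} (a·ω)(b·ω) dσ(ω) = (4π/3) (a·b)` (CIP 1994 §3.1; the isotropic tensor `∫ ω⊗ω dσ = (4π/3) I`).
Proof: the Gaussian integrals `∫ (a·x)(b·x)M = a·b` and `∫ |x|²M = 3` over `ℝ³`, written in polar
coordinates, are `S(a,b)·K` and `4π·K` with the same radial factor `K`. [cite: CIP1994, §3.1] -/
theorem k2r_integral_inner_mul_inner_sphereMeasure (a b : EuclideanSpace ℝ (Fin 3)) :
    ∫ ω : sphere (0 : EuclideanSpace ℝ (Fin 3)) 1, ⟪a, ω⟫_ℝ * ⟪b, ω⟫_ℝ ∂sphereMeasure =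
      4 * π / 3 * ⟪a, b⟫_ℝ := by
  set K : ℝ := ∫ r in Ioi (0 : ℝ), r ^ 4 * ((2 * π) ^ (-(3 : ℝ) / 2) * rexp (-r ^ 2 / 2)) with hK
  set S : ℝ := ∫ ω : sphere (0 : EuclideanSpace ℝ (Fin 3)) 1, ⟪a, ω⟫_ℝ * ⟪b, ω⟫_ℝ ∂sphereMeasure
    with hS
  -- (A) the mixed second moment
  have hA : S * K = ⟪a, b⟫_ℝ :=
    calc S * K = ∫ x, globalMaxwellian x * (⟪a, x⟫_ℝ * ⟪b, x⟫_ℝ) :=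
          (k2r_integral_globalMaxwellian_mul_of_homog (fun x => ⟪a, x⟫_ℝ * ⟪b, x⟫_ℝ)
            (fun c _ x => by simp only [inner_smul_right]; ring)).symm
      _ = ∫ x, ⟪a, x⟫_ℝ * ⟪b, x⟫_ℝ ∂stdGaussian (EuclideanSpace ℝ (Fin 3)) :=
          (integral_stdGaussian_eq_integral_mul_globalMaxwellian _).symm
      _ = ⟪a, b⟫_ℝ := k2r_integral_inner_mul_inner_stdGaussian a b
  -- (B) the trace: `4π K = 3`
  have hB : 4 * π * K = 3 := by
    have hSn : ∫ ω : sphere (0 : EuclideanSpace ℝ (Fin 3)) 1,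
        ‖((ω : sphere (0 : EuclideanSpace ℝ (Fin 3)) 1) : EuclideanSpace ℝ (Fin 3))‖ ^ 2 ∂sphereMeasure
        = 4 * π := by
      have h1 : ∀ ω : sphere (0 : EuclideanSpace ℝ (Fin 3)) 1,
          ‖(ω : EuclideanSpace ℝ (Fin 3))‖ ^ 2 = 1 := fun ω => by
        rw [norm_eq_of_mem_sphere ω]; norm_num
      simp_rw [h1]
      rw [integral_const, smul_eq_mul, mul_one, k2r_sphereMeasure_real_univ]
    calc 4 * π * K = ∫ x, globalMaxwellian x * ‖x‖ ^ 2 := by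
          rw [k2r_integral_globalMaxwellian_mul_of_homog (fun x => ‖x‖ ^ 2) (fun c hc x => by
            rw [norm_smul, Real.norm_eq_abs, abs_of_pos hc]; ring), hSn]
      _ = ∫ x, ‖x‖ ^ 2 ∂stdGaussian (EuclideanSpace ℝ (Fin 3)) :=
          (integral_stdGaussian_eq_integral_mul_globalMaxwellian _).symm
      _ = 3 := by rw [integral_norm_sq_stdGaussian]; simp
  linear_combination (4 * π / 3) * hA - (S / 3) * hB

/-! ## (i) Finite differences against a smooth weight on `𝕋³` -/

/-- `dist (x + proj v) x ≤ ‖v‖` on the flat torus (the quotient map is norm-non-increasing,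
`Torus.norm_proj_le`). [folklore] -/
theorem k2r_dist_add_proj_le (x : T3) (v : V3) : dist (x + Torus.proj v) x ≤ ‖v‖ := by
  rw [dist_eq_norm, add_sub_cancel_left]
  exact Torus.norm_proj_le v

/-- The flat torus `𝕋³` has two distinct points (`0` and the image of `(1/2,1/2,1/2)`). [folklore] -/
theorem k2r_exists_ne_zero_T3 : ∃ x : T3, x ≠ 0 := by
  refine ⟨fun _ => ((1 / 2 : ℝ) : UnitAddCircle), fun h => ?_⟩
  have h0 : ((1 / 2 : ℝ) : UnitAddCircle) = 0 := congrFun h 0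
  rw [AddCircle.coe_eq_zero_iff_of_mem_Ico (by norm_num : (1 / 2 : ℝ) ∈ Set.Ico 0 1)] at h0
  norm_num at h0

/-- **First-order Taylor remainder along a torus translation.** For `W` smooth on `𝕋³` with
`∇W` `K₂`-Lipschitz (`K₂ ≥ 0`), `|W(x) − W(x − v) − ∇W(x)·v| ≤ K₂ ‖v‖²`: the fundamental theorem
of calculus along `τ ↦ x − v + τv` (`Torus.hasDerivAt_comp_add_proj_smul`) and
`dist(x − v + τv, x) ≤ (1 − τ)‖v‖ ≤ ‖v‖`. [folklore] -/
theorem k2r_abs_taylor_remainder_le {W : T3 → ℝ} (hW : Torus.IsSmooth W) {K₂ : ℝ}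
    (hK : ∀ x x' : T3, ‖Torus.gradient W x - Torus.gradient W x'‖ ≤ K₂ * dist x x')
    (hK0 : 0 ≤ K₂) (x : T3) (v : V3) :
    |W x - W (x - Torus.proj v) - ⟪Torus.gradient W x, v⟫_ℝ| ≤ K₂ * ‖v‖ ^ 2 := by
  have hW1 : Torus.IsContDiff 1 W := hW.isContDiff (by simp)
  set y : T3 := x - Torus.proj v with hy
  set g' : ℝ → ℝ := fun τ => ⟪Torus.gradient W (y + Torus.proj (τ • v)), v⟫_ℝ with hg'
  have hderiv : ∀ τ : ℝ, HasDerivAt (fun s : ℝ => W (y + Torus.proj (s • v))) (g' τ) τ := by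
    intro τ
    have h := Torus.hasDerivAt_comp_add_proj_smul hW1 y v τ
    rwa [Torus.lineDeriv_eq_fderiv_apply hW1, ← Torus.inner_gradient_left] at h
  have hcont : Continuous g' := by
    have hg : Continuous (Torus.gradient W) := hW.gradient.continuous
    exact (hg.comp (continuous_const.add
      (Torus.continuous_proj.comp (continuous_id.smul continuous_const)))).inner continuous_const
  have hftc : ∫ τ in (0 : ℝ)..1, g' τ = W x - W y := by
    rw [intervalIntegral.integral_eq_sub_of_hasDerivAt (fun τ _ => hderiv τ) (hcont.intervalIntegrable 0 1)]
    simp only [one_smul, zero_smul, Torus.proj_zero, add_zero]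
    rw [hy, sub_add_cancel]
  have hrem : W x - W y - ⟪Torus.gradient W x, v⟫_ℝ =
      ∫ τ in (0 : ℝ)..1, (g' τ - ⟪Torus.gradient W x, v⟫_ℝ) := by
    rw [intervalIntegral.integral_sub (hcont.intervalIntegrable 0 1) intervalIntegrable_const,
      hftc, intervalIntegral.integral_const, sub_zero, one_smul]
  rw [hrem]
  have hbound : ∀ τ ∈ Set.uIoc (0 : ℝ) 1, ‖g' τ - ⟪Torus.gradient W x, v⟫_ℝ‖ ≤ K₂ * ‖v‖ ^ 2 := by
    intro τ hτ
    rw [Set.uIoc_of_le zero_le_one] at hτ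
    rw [hg', ← inner_sub_left]
    refine (norm_inner_le_norm _ _).trans ?_
    have hdist : dist (y + Torus.proj (τ • v)) x ≤ ‖v‖ := by
      have e : y + Torus.proj (τ • v) = x + Torus.proj ((τ - 1) • v) := by
        have hs : Torus.proj ((τ - 1) • v) = Torus.proj (τ • v) - Torus.proj v := by
          rw [sub_smul, one_smul]; rfl
        rw [hs, hy]
        abel
      rw [e]
      refine (k2r_dist_add_proj_le x _).trans ?_
      rw [norm_smul, Real.norm_eq_abs, abs_sub_comm, abs_of_nonneg (by linarith [hτ.2])]
      nlinarith [norm_nonneg v, hτ.1, hτ.2]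
    calc ‖Torus.gradient W (y + Torus.proj (τ • v)) - Torus.gradient W x‖ * ‖v‖
        ≤ (K₂ * dist (y + Torus.proj (τ • v)) x) * ‖v‖ := by gcongr; exact hK _ _
      _ ≤ (K₂ * ‖v‖) * ‖v‖ := by gcongr
      _ = K₂ * ‖v‖ ^ 2 := by ring
  have h := intervalIntegral.norm_integral_le_of_norm_le_const hbound
  rwa [sub_zero, abs_one, mul_one, Real.norm_eq_abs] at h

/-- **Finite differences against a smooth weight are gradients up to `O(ε²)`.** For `W` smooth on
`𝕋³` with `∇W` `K₂`-Lipschitz, `β` continuous with `|β| ≤ C_β`, `‖a‖ ≤ 1` and every `ε`,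
`|∫ W(x)(β(x) − β(x+εa)) dx − ε ∫ (a·∇W(x)) β(x) dx| ≤ K₂ C_β ε²`.  Translation invariance of Haar
measure on `𝕋³` (`∫ W(x)β(x+p) dx = ∫ W(x−p)β(x) dx`) moves the finite difference onto `W`; then
`k2r_abs_taylor_remainder_le` pointwise and `vol(𝕋³) = 1`. [folklore] -/
theorem k2r_abs_integral_mul_sub_translate_sub_le (W : T3 → ℝ) (hW : Torus.IsSmooth W) (K₂ : ℝ)
    (hK : ∀ x x' : T3, ‖Torus.gradient W x - Torus.gradient W x'‖ ≤ K₂ * dist x x')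
    (β : T3 → ℝ) (hβ : Continuous β) (Cβ : ℝ) (hCβ : ∀ x, |β x| ≤ Cβ) (ε : ℝ) (a : V3)
    (ha : ‖a‖ ≤ 1) :
    |(∫ x : T3, W x * (β x - β ((Torus.geometry (Fin 3)).translate x (ε • a)))) -
        ε * ∫ x : T3, ⟪a, Torus.gradient W x⟫_ℝ * β x| ≤ K₂ * Cβ * ε ^ 2 := by
  -- signs of the constants
  have hK0 : 0 ≤ K₂ := by
    obtain ⟨x₁, hx₁⟩ := k2r_exists_ne_zero_T3
    have hd : 0 < dist x₁ 0 := dist_pos.2 hx₁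
    exact nonneg_of_mul_nonneg_left ((norm_nonneg _).trans (hK x₁ 0)) hd
  set v : V3 := ε • a with hv
  set p : T3 := Torus.proj v with hp
  change |(∫ x : T3, W x * (β x - β (x + p))) - ε * ∫ x : T3, ⟪a, Torus.gradient W x⟫_ℝ * β x| ≤ _
  have hWc : Continuous W := hW.continuous
  have hGc : Continuous (Torus.gradient W) := hW.gradient.continuous
  -- translation invariance of Haar measure on `𝕋³`
  have h1 : ∫ x : T3, W x * β (x + p) = ∫ x : T3, W (x - p) * β x := by
    have h := integral_add_right_eq_self (μ := (volume : Measure T3)) (fun x => W (x - p) * β x) p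
    simp only [add_sub_cancel_right] at h
    exact h
  have hi1 : Integrable (fun x => W x * β x) := (hWc.mul hβ).integrable_unitAddTorus
  have hi2 : Integrable (fun x => W x * β (x + p)) :=
    (hWc.mul (hβ.comp (continuous_id.add continuous_const))).integrable_unitAddTorus
  have hi3 : Integrable (fun x => W (x - p) * β x) :=
    ((hWc.comp (continuous_id.sub continuous_const)).mul hβ).integrable_unitAddTorus
  have hi4 : Integrable (fun x => ⟪Torus.gradient W x, v⟫_ℝ * β x) :=
    ((hGc.inner continuous_const).mul hβ).integrable_unitAddTorus
  set R : T3 → ℝ := fun x => W x - W (x - p) - ⟪Torus.gradient W x, v⟫_ℝ with hR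
  have hkey : (∫ x : T3, W x * (β x - β (x + p))) - ε * ∫ x : T3, ⟪a, Torus.gradient W x⟫_ℝ * β x
      = ∫ x : T3, R x * β x := by
    have e1 : ∫ x : T3, W x * (β x - β (x + p)) = (∫ x, W x * β x) - ∫ x, W (x - p) * β x := by
      rw [← h1, ← integral_sub hi1 hi2]
      exact integral_congr_ae (Eventually.of_forall fun x => by ring)
    have e2 : ε * ∫ x : T3, ⟪a, Torus.gradient W x⟫_ℝ * β x =
        ∫ x : T3, ⟪Torus.gradient W x, v⟫_ℝ * β x := by
      rw [← integral_const_mul]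
      refine integral_congr_ae (Eventually.of_forall fun x => ?_)
      simp only [hv, inner_smul_right, real_inner_comm a]
      ring
    have hi13 : Integrable (fun x => W x * β x - W (x - p) * β x) := hi1.sub hi3
    rw [e1, e2, ← integral_sub hi1 hi3, ← integral_sub hi13 hi4]
    exact integral_congr_ae (Eventually.of_forall fun x => by simp only [hR]; ring)
  rw [hkey]
  -- pointwise bound on the remainder and integration over the probability space `𝕋³`
  have hv1 : ‖v‖ ^ 2 ≤ ε ^ 2 := by
    have hvn : ‖v‖ ≤ |ε| := by
      rw [hv, norm_smul, Real.norm_eq_abs]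
      exact mul_le_of_le_one_right (abs_nonneg _) ha
    rw [← sq_abs ε]
    exact pow_le_pow_left₀ (norm_nonneg _) hvn 2
  have hRb : ∀ x, |R x| ≤ K₂ * ε ^ 2 := fun x =>
    (k2r_abs_taylor_remainder_le hW hK hK0 x v).trans (mul_le_mul_of_nonneg_left hv1 hK0)
  have h := norm_integral_le_of_norm_le_const (μ := (volume : Measure T3)) (f := fun x => R x * β x)
    (C := K₂ * ε ^ 2 * Cβ) (Eventually.of_forall fun x => by
      rw [norm_mul, Real.norm_eq_abs, Real.norm_eq_abs]
      exact mul_le_mul (hRb x) (hCβ x) (abs_nonneg _) (by positivity))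
  rw [probReal_univ, mul_one, Real.norm_eq_abs] at h
  calc |∫ x, R x * β x| ≤ K₂ * ε ^ 2 * Cβ := h
    _ = K₂ * Cβ * ε ^ 2 := by ring

/-! ## The registered stub statement -/

/-- **Stub B3b `stub_spatialTransfer` of the K2R birth line** — spatial and angular averaging of the
collisional transfer: (i) finite differences against a smooth weight on `𝕋³` are gradients up to
`O(ε²)` (`k2r_abs_integral_mul_sub_translate_sub_le`); (ii) second moments of the surface measure of
`S²`, `∫ (a·ω)(b·ω) dσ = (4π/3) a·b` (`k2r_integral_inner_mul_inner_sphereMeasure`).  Verbatim the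
Prop `SpatialTransfer` of `Cruxes/AdjointEnskogTestFamilyR/Lines/birth.lean`. [cite: CIP1994, §3.1] -/
theorem stub_spatialTransfer :
  (∀ (W : UnitAddTorus (Fin 3) → ℝ), Literature.Analysis.FunctionSpaces.Torus.IsSmooth W → ∀ (K₂ : ℝ),
     (∀ x x' : UnitAddTorus (Fin 3), ‖Literature.Analysis.FunctionSpaces.Torus.gradient W x -
        Literature.Analysis.FunctionSpaces.Torus.gradient W x'‖ ≤ K₂ * dist x x') →
     ∀ (β : UnitAddTorus (Fin 3) → ℝ), Continuous β → ∀ (Cβ : ℝ), (∀ x, |β x| ≤ Cβ) →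
     ∀ (ε : ℝ) (a : EuclideanSpace ℝ (Fin 3)), ‖a‖ ≤ 1 →
     |(∫ x : UnitAddTorus (Fin 3), W x * (β x - β ((Literature.Analysis.FluidPDE.Torus.geometry (Fin 3)).translate x (ε • a)))) -
        ε * ∫ x : UnitAddTorus (Fin 3), inner ℝ a (Literature.Analysis.FunctionSpaces.Torus.gradient W x) * β x| ≤
       K₂ * Cβ * ε ^ 2) ∧
  (∀ a b : EuclideanSpace ℝ (Fin 3),
     ∫ ω : Metric.sphere (0 : EuclideanSpace ℝ (Fin 3)) 1, inner ℝ a ω * inner ℝ b ω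
        ∂Literature.MathematicalPhysics.KineticTheory.sphereMeasure = 4 * Real.pi / 3 * inner ℝ a b) :=
  ⟨k2r_abs_integral_mul_sub_translate_sub_le, k2r_integral_inner_mul_inner_sphereMeasure⟩

end Summit.AtomisticToContinuum.HydrodynamicLimit.Theorems.EnskogAdjointDuality

end
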